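import Literature.NumberTheory.GaloisCohomology.Howard2004.ResidualSelmerEigenParityProofs
import Literature.NumberTheory.GaloisCohomology.Howard2004.DVRSettingEngineEpsilonRhoProofs
import HarnessLib

/-!
# Howard 2004, Lemma 1.5.3 «in particular `ρ(n) (mod 2)` is independent of `n`» at an ARBITRARY prime of
# `𝓛^{(2k-1)}`: the parity binder `hpar` of the engine's Prop. 1.5.9 from the Lemma 1.5.3 letters (proofs file)

Topic `NumberTheory/GaloisCohomology/Howard2004`. THEOREMS ONLY: no definition, no named fact, no instance, no
notation, no `sorry`. Sequel of `ResidualSelmerEigenParityProofs` (x10b-p1-w6 g9: Lemma 1.5.3 (a)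
`length_eigen_insert_add_one_eq` / (b) `length_eigen_insert_eq_add_one` between the eigenparts of the residual level
Selmer groups `Sel_{F̄_k(nℓ)} ⊓ E` and `Sel_{F̄_k(n)} ⊓ E` on a `DVRSetting`, with the Galois inputs `hdis` (Prop. 1.1.9),
`hGD` (the (GD-line) count) and `hor` (the isotropy dichotomy) as BINDERS) and `DVRSettingEngineEpsilonRhoProofs`
(x9-p1 LEAD g9, (PAR-ASM): `finrank_torsionBy_mod_two_eq_of_rho` — `dim 𝓗(n)[π] ≡ dim 𝓗(nq)[π] (mod 2)` GIVEN the
dichotomies `ρ±(nq) ∈ {ρ±(n) − 1, ρ±(n) + 1}`). Cell `pub/bsd-print-x9`; print leaf G87 = `thm161_dvrKolyvaginBound`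
(Howard Thm. 1.6.1), registered pseudo-stub `stub_h161` of the μ-crux `MuInequalityCoherentPair`
(stmt-BirchSwinnertonDyer-22642); seat `bsd-line-x10b-p1-w7` g10, brick (HPAR-PLUG).

SOURCE. B. Howard, *The Heegner point Kolyvagin system*, Compositio Math. **140** (2004) = arXiv:1202.6340, Lemma 1.5.3
(p0009 L139 – p0010 L45: «(a) if `loc_ℓ(𝓗̄(n)^±) ≠ 0` then `ρ(nℓ)^± = ρ(n)^± − 1`; (b) if `loc_ℓ(𝓗̄(n)^±) = 0` then
`ρ(nℓ)^± = ρ(n)^± + 1`. In particular this implies that `ρ(n) (mod 2)` is independent of `n ∈ 𝓝`») and the proof of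
Prop. 1.5.9 (p0010 L139–141: «`ε` is independent of `n`», used through Prop. 1.5.5).

WHAT IS PROVED (bookkeeping; every Galois input stays a hypothesis in the binder shapes the engine bricks already use):
* §1 **`DVRSetting.length_eigen_insert_dichotomy`** — (a) OR (b) at a prime `v ∉ n`, for an `R_k`-stable subgroup `E`
  (excluded middle on «some class of `Sel_{F̄(n)} ⊓ E` is locally non-zero at `v`»), the `R_k`-stability witnesses of
  the two `Module.length` terms being ARBITRARY (`w₁`, `w₀`), so that consumers may quote their own;
* §2 **`DVRSetting.rho_insert_dichotomy_plus` / `_minus`** — `ρ±(nv) + 1 = ρ±(n) ∨ ρ±(nv) = ρ±(n) + 1` in `ℕ` for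
  eigen-counts `ρ±` identified with the lengths of `𝓗̄(n)^± = Sel_{F̄_k(n)} ⊓ ker(τ_* ∓ id)` (the letters `hρp` / `hρm`
  of `DVRSettingEngineRhoProofs.exists_eigenLengths`), from `hdis`, `hGD±`, `hor±` at `v` in the binder shapes of
  `DVRSettingEngineChebProofs.exists_enginePrime_caseI`;
* §3 **`DVRSetting.engine_hpar_of_letters`** — the binder `hpar` of `DVRSettingEngineH159Proofs.engine_h159`
  VERBATIM (`∀ k n q, n ⊆ 𝓛^{(2k-1)} → q ∈ 𝓛^{(2k-1)} → q ∉ n → dim 𝓗(n)[π] ≡ dim 𝓗(nq)[π] (mod 2)`) from the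
  eigen-counts and the five letters quantified over all `(k, n)`.

HONEST FRAMING: the letters `hdis` / `hGD±` / `hor±` (Prop. 1.1.9, the (GD-line) count, the local isotropy
dichotomy — global duality at the residual level) are NOT proved here; `thm161_dvrKolyvaginBound` is NOT proved; no
summit statement is proved; the Birch–Swinnerton-Dyer conjecture is not proved by any of this.
-/

set_option autoImplicit false

noncomputable section

open Function NumberField IsDedekindDomain Field Module Submodule
open scoped NumberField ContRepresentation Classical

namespace Literature.NumberTheory.GaloisCohomology.Howard2004

open Literature.NumberTheory.GaloisRepresentations
open Literature.NumberTheory.GaloisRepresentations.DiscreteGaloisModule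
open Literature.NumberTheory.GaloisRepresentations.galoisCohomology
open Literature.NumberTheory.EllipticCurves

namespace DVRSetting

variable {p : ℕ} [Fact p.Prime] {K : Type} [Field K] [NumberField K]
  {R : Type} [CommRing R] [IsDomain R] [IsDiscreteValuationRing R] [Algebra ℤ_[p] R]
  {N : ℕ → Type} [∀ k, AddCommGroup (N k)] [∀ k, TopologicalSpace (N k)]
  [∀ k, DiscreteTopology (N k)] [∀ k, Module R (N k)]
  {Rk : ℕ → Type} [∀ k, CommRing (Rk k)] [∀ k, IsLocalRing (Rk k)] [∀ k, TopologicalSpace (Rk k)]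
  [∀ k, DiscreteTopology (Rk k)] [∀ k, Algebra ℤ_[p] (Rk k)] [∀ k, Algebra R (Rk k)]
  [∀ k, Module (Rk k) (N k)] [∀ k, IsScalarTower R (Rk k) (N k)]
  {Nbar : Type} [AddCommGroup Nbar] [TopologicalSpace Nbar] [DiscreteTopology Nbar]
  [∀ k, Module (Rk k) Nbar]
  {Nq : ℕ → Finset (HeightOneSpectrum (𝓞 K)) → Type} [∀ k n, AddCommGroup (Nq k n)]
  [∀ k n, TopologicalSpace (Nq k n)] [∀ k n, DiscreteTopology (Nq k n)]
  [∀ k n, Module (Rk k) (Nq k n)] [∀ k n, Module R (Nq k n)]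
  [∀ k n, IsScalarTower R (Rk k) (Nq k n)]

/-! ## §1 Lemma 1.5.3 (a) OR (b) at a prime `v ∉ n` -/

/-- **Lemma 1.5.3, both cases, at a prime `v ∉ n`** for an `R_k`-stable subgroup `E` of `H¹(K, T̄)` (e.g.
`ker(τ_* ∓ id)`): given `F̄_v ∩ 𝒯̄_v = 0`, the (GD-line) count and the isotropy dichotomy for the relaxed group
`Sel_{F̄^v(n)} ⊓ E`, EITHER `length (Sel_{F̄(nv)} ⊓ E) + 1 = length (Sel_{F̄(n)} ⊓ E)` (case (a): some class of
`Sel_{F̄(n)} ⊓ E` is locally non-zero at `v`) OR `length (Sel_{F̄(nv)} ⊓ E) = length (Sel_{F̄(n)} ⊓ E) + 1` (case (b)).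
The `R_k`-stability witnesses `w₁`, `w₀` of the two lengths are arbitrary (the submodules do not depend on them).
[cite: Howard2004HeegnerKolyvagin, Lemma 1.5.3 (a)/(b) (arXiv:1202.6340 p. 9 L139–146, p. 10 L1–45)] -/
theorem length_eigen_insert_dichotomy (S : DVRSetting p K R N Rk Nbar Nq) (hy : S.SatisfiesH) (k : ℕ)
    {n : Finset (HeightOneSpectrum (𝓞 K))} {v : HeightOneSpectrum (𝓞 K)} (hvn : v ∉ n)
    (E : AddSubgroup (galoisCohomology S.ρbar 1))
    (hE : ∀ (r : Rk k) {x}, x ∈ E → galoisCohomology.scalarMapH1 S.ρbar (S.isScalarLinear_rhobar hy k) r x ∈ E)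
    (hdis : Disjoint (((hy.h1 k).1.propagateStructure (S.t k).cond) (Sum.inr v))
      ((transverseStructure p S.ρbar S.jbar) (Sum.inr v)))
    (hGD : letI := (galoisCohomology.moduleH1 (S.ρbar.toLocal (Sum.inr v))
        ((S.isScalarLinear_rhobar hy k).restrictField (Place.Completion (Sum.inr v))));
      Module.length (Rk k) ↥(galoisCohomology.submoduleOfStable
        ((S.isScalarLinear_rhobar hy k).restrictField (Place.Completion (Sum.inr v)))
        (((((hy.h1 k).1.propagateStructure (S.t k).cond).modify (transverseStructure p S.ρbar S.jbar)
            {v} ∅ n).selmerGroup ⊓ E).map (galoisCohomology.localization S.ρbar (Sum.inr v) 1))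
        (scalarMapH1_mem_map_localization S.ρbar (S.isScalarLinear_rhobar hy k) (Sum.inr v)
          (scalarMapH1_mem_inf S.ρbar (S.isScalarLinear_rhobar hy k)
            (S.scalarMapH1_mem_residualSelmer_modify hy k {v} ∅ n) hE))) = 1)
    (hor : ((((hy.h1 k).1.propagateStructure (S.t k).cond).modify (transverseStructure p S.ρbar S.jbar)
            {v} ∅ n).selmerGroup ⊓ E).map (galoisCohomology.localization S.ρbar (Sum.inr v) 1) ≤
          ((hy.h1 k).1.propagateStructure (S.t k).cond) (Sum.inr v) ∨
      ((((hy.h1 k).1.propagateStructure (S.t k).cond).modify (transverseStructure p S.ρbar S.jbar)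
            {v} ∅ n).selmerGroup ⊓ E).map (galoisCohomology.localization S.ρbar (Sum.inr v) 1) ≤
          (transverseStructure p S.ρbar S.jbar) (Sum.inr v))
    (w₁ : ∀ (r : Rk k) {x},
      x ∈ (((hy.h1 k).1.propagateStructure (S.t k).cond).modify (transverseStructure p S.ρbar S.jbar)
          ∅ ∅ (insert v n)).selmerGroup ⊓ E →
        galoisCohomology.scalarMapH1 S.ρbar (S.isScalarLinear_rhobar hy k) r x ∈
          (((hy.h1 k).1.propagateStructure (S.t k).cond).modify (transverseStructure p S.ρbar S.jbar)
            ∅ ∅ (insert v n)).selmerGroup ⊓ E)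
    (w₀ : ∀ (r : Rk k) {x},
      x ∈ (((hy.h1 k).1.propagateStructure (S.t k).cond).modify (transverseStructure p S.ρbar S.jbar)
          ∅ ∅ n).selmerGroup ⊓ E →
        galoisCohomology.scalarMapH1 S.ρbar (S.isScalarLinear_rhobar hy k) r x ∈
          (((hy.h1 k).1.propagateStructure (S.t k).cond).modify (transverseStructure p S.ρbar S.jbar)
            ∅ ∅ n).selmerGroup ⊓ E) :
    letI := galoisCohomology.moduleH1 S.ρbar (S.isScalarLinear_rhobar hy k)
    Module.length (Rk k) ↥(galoisCohomology.submoduleOfStable (S.isScalarLinear_rhobar hy k)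
        ((((hy.h1 k).1.propagateStructure (S.t k).cond).modify (transverseStructure p S.ρbar S.jbar)
          ∅ ∅ (insert v n)).selmerGroup ⊓ E) w₁) + 1 =
      Module.length (Rk k) ↥(galoisCohomology.submoduleOfStable (S.isScalarLinear_rhobar hy k)
        ((((hy.h1 k).1.propagateStructure (S.t k).cond).modify (transverseStructure p S.ρbar S.jbar)
          ∅ ∅ n).selmerGroup ⊓ E) w₀) ∨
    Module.length (Rk k) ↥(galoisCohomology.submoduleOfStable (S.isScalarLinear_rhobar hy k)
        ((((hy.h1 k).1.propagateStructure (S.t k).cond).modify (transverseStructure p S.ρbar S.jbar)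
          ∅ ∅ (insert v n)).selmerGroup ⊓ E) w₁) =
      Module.length (Rk k) ↥(galoisCohomology.submoduleOfStable (S.isScalarLinear_rhobar hy k)
        ((((hy.h1 k).1.propagateStructure (S.t k).cond).modify (transverseStructure p S.ρbar S.jbar)
          ∅ ∅ n).selmerGroup ⊓ E) w₀) + 1 := by
  by_cases hne : ∃ c ∈ (((hy.h1 k).1.propagateStructure (S.t k).cond).modify
      (transverseStructure p S.ρbar S.jbar) ∅ ∅ n).selmerGroup ⊓ E,
      (galoisCohomology.localization S.ρbar (Sum.inr v) 1) c ≠ 0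
  · exact Or.inl (S.length_eigen_insert_add_one_eq hy k hvn E hE hdis hGD hor hne)
  · refine Or.inr (S.length_eigen_insert_eq_add_one hy k hvn E hE hdis hGD hor ?_)
    intro c hc
    by_contra h0
    exact hne ⟨c, hc, h0⟩

/-! ## §2 `ρ±(nv) ∈ {ρ±(n) − 1, ρ±(n) + 1}` for the eigen-counts -/

/-- **Lemma 1.5.3 for `ρ⁺` at a prime `v ∈ 𝓛^{(2k-1)} ∖ n`**: with `ρ⁺(k, m)` identified with the length of
`𝓗̄_k(m)⁺ = Sel_{F̄_k(m)} ⊓ ker(τ_* − id)` for `m ⊆ 𝓛^{(2k-1)}` (the letter `hρp` of `exists_eigenLengths`), the three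
letters `hdis`, `hGDp`, `horp` at `v` (binder shapes of `exists_enginePrime_caseI`) give
`ρ⁺(nv) + 1 = ρ⁺(n) ∨ ρ⁺(nv) = ρ⁺(n) + 1`.
[cite: Howard2004HeegnerKolyvagin, Lemma 1.5.3 (a)/(b) (arXiv:1202.6340 p. 9 L139–146, p. 10 L1–45)] -/
theorem rho_insert_dichotomy_plus (S : DVRSetting p K R N Rk Nbar Nq) (hy : S.SatisfiesH) (k : ℕ)
    (ρp : ℕ → Finset (HeightOneSpectrum (𝓞 K)) → ℕ)
    (hρp : ∀ m : Finset (HeightOneSpectrum (𝓞 K)), ↑m ⊆ S.enginePrimes k →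
      letI := galoisCohomology.moduleH1 S.ρbar (S.isScalarLinear_rhobar hy k)
      (ρp k m : ℕ∞) = Module.length (Rk k) ↥(galoisCohomology.submoduleOfStable (S.isScalarLinear_rhobar hy k)
        ((((hy.h1 k).1.propagateStructure (S.t k).cond).modify (transverseStructure p S.ρbar S.jbar)
            ∅ ∅ m).selmerGroup ⊓
          (semilinearH S.cd.isLift (S.A k).θ.toAddMonoidHom (S.A k).isSemilinear 1 - AddMonoidHom.id _).ker)
        (S.scalarMapH1_mem_residualSelmer_inf_ker_sub hy k ∅ ∅ m)))
    {n : Finset (HeightOneSpectrum (𝓞 K))} {v : HeightOneSpectrum (𝓞 K)}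
    (hn : ↑n ⊆ S.enginePrimes k) (hv : v ∈ S.enginePrimes k) (hvn : v ∉ n)
    (hdis : Disjoint (((hy.h1 k).1.propagateStructure (S.t k).cond) (Sum.inr v))
      (transverseStructure p S.ρbar S.jbar (Sum.inr v)))
    (hGDp : letI := (galoisCohomology.moduleH1 (S.ρbar.toLocal (Sum.inr v))
        ((S.isScalarLinear_rhobar hy k).restrictField (Place.Completion (Sum.inr v))));
      Module.length (Rk k) ↥(galoisCohomology.submoduleOfStable
        ((S.isScalarLinear_rhobar hy k).restrictField (Place.Completion (Sum.inr v)))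
        ((((((hy.h1 k).1.propagateStructure (S.t k).cond).modify (transverseStructure p S.ρbar S.jbar)
            {v} ∅ n)).selmerGroup ⊓
          (semilinearH S.cd.isLift (S.A k).θ.toAddMonoidHom (S.A k).isSemilinear 1 - AddMonoidHom.id _).ker).map
          (galoisCohomology.localization S.ρbar (Sum.inr v) 1))
        (scalarMapH1_mem_map_localization S.ρbar (S.isScalarLinear_rhobar hy k) (Sum.inr v)
          (scalarMapH1_mem_inf S.ρbar (S.isScalarLinear_rhobar hy k)
            (S.scalarMapH1_mem_residualSelmer_modify hy k {v} ∅ n) (S.scalarMapH1_mem_kerSub hy k)))) = 1)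
    (horp : (((((hy.h1 k).1.propagateStructure (S.t k).cond).modify (transverseStructure p S.ρbar S.jbar)
            {v} ∅ n)).selmerGroup ⊓
          (semilinearH S.cd.isLift (S.A k).θ.toAddMonoidHom (S.A k).isSemilinear 1 - AddMonoidHom.id _).ker).map
          (galoisCohomology.localization S.ρbar (Sum.inr v) 1) ≤
          ((hy.h1 k).1.propagateStructure (S.t k).cond) (Sum.inr v) ∨
      (((((hy.h1 k).1.propagateStructure (S.t k).cond).modify (transverseStructure p S.ρbar S.jbar)
            {v} ∅ n)).selmerGroup ⊓
          (semilinearH S.cd.isLift (S.A k).θ.toAddMonoidHom (S.A k).isSemilinear 1 - AddMonoidHom.id _).ker).map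
          (galoisCohomology.localization S.ρbar (Sum.inr v) 1) ≤
          transverseStructure p S.ρbar S.jbar (Sum.inr v)) :
    ρp k (insert v n) + 1 = ρp k n ∨ ρp k (insert v n) = ρp k n + 1 := by
  have h := S.length_eigen_insert_dichotomy hy k hvn _ (S.scalarMapH1_mem_kerSub hy k) hdis hGDp horp
    (S.scalarMapH1_mem_residualSelmer_inf_ker_sub hy k ∅ ∅ (insert v n))
    (S.scalarMapH1_mem_residualSelmer_inf_ker_sub hy k ∅ ∅ n)
  rw [← hρp _ (S.insert_subset_enginePrimes hn hv), ← hρp n hn] at h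
  exact_mod_cast h

/-- **Lemma 1.5.3 for `ρ⁻` at a prime `v ∈ 𝓛^{(2k-1)} ∖ n`**: the sign `−` twin of `rho_insert_dichotomy_plus`
(`𝓗̄_k(m)⁻ = Sel_{F̄_k(m)} ⊓ ker(τ_* + id)`, letters `hρm`, `hdis`, `hGDm`, `horm`):
`ρ⁻(nv) + 1 = ρ⁻(n) ∨ ρ⁻(nv) = ρ⁻(n) + 1`.
[cite: Howard2004HeegnerKolyvagin, Lemma 1.5.3 (a)/(b) (arXiv:1202.6340 p. 9 L139–146, p. 10 L1–45)] -/
theorem rho_insert_dichotomy_minus (S : DVRSetting p K R N Rk Nbar Nq) (hy : S.SatisfiesH) (k : ℕ)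
    (ρm : ℕ → Finset (HeightOneSpectrum (𝓞 K)) → ℕ)
    (hρm : ∀ m : Finset (HeightOneSpectrum (𝓞 K)), ↑m ⊆ S.enginePrimes k →
      letI := galoisCohomology.moduleH1 S.ρbar (S.isScalarLinear_rhobar hy k)
      (ρm k m : ℕ∞) = Module.length (Rk k) ↥(galoisCohomology.submoduleOfStable (S.isScalarLinear_rhobar hy k)
        ((((hy.h1 k).1.propagateStructure (S.t k).cond).modify (transverseStructure p S.ρbar S.jbar)
            ∅ ∅ m).selmerGroup ⊓
          (semilinearH S.cd.isLift (S.A k).θ.toAddMonoidHom (S.A k).isSemilinear 1 + AddMonoidHom.id _).ker)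
        (S.scalarMapH1_mem_residualSelmer_inf_ker_add hy k ∅ ∅ m)))
    {n : Finset (HeightOneSpectrum (𝓞 K))} {v : HeightOneSpectrum (𝓞 K)}
    (hn : ↑n ⊆ S.enginePrimes k) (hv : v ∈ S.enginePrimes k) (hvn : v ∉ n)
    (hdis : Disjoint (((hy.h1 k).1.propagateStructure (S.t k).cond) (Sum.inr v))
      (transverseStructure p S.ρbar S.jbar (Sum.inr v)))
    (hGDm : letI := (galoisCohomology.moduleH1 (S.ρbar.toLocal (Sum.inr v))
        ((S.isScalarLinear_rhobar hy k).restrictField (Place.Completion (Sum.inr v))));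
      Module.length (Rk k) ↥(galoisCohomology.submoduleOfStable
        ((S.isScalarLinear_rhobar hy k).restrictField (Place.Completion (Sum.inr v)))
        ((((((hy.h1 k).1.propagateStructure (S.t k).cond).modify (transverseStructure p S.ρbar S.jbar)
            {v} ∅ n)).selmerGroup ⊓
          (semilinearH S.cd.isLift (S.A k).θ.toAddMonoidHom (S.A k).isSemilinear 1 + AddMonoidHom.id _).ker).map
          (galoisCohomology.localization S.ρbar (Sum.inr v) 1))
        (scalarMapH1_mem_map_localization S.ρbar (S.isScalarLinear_rhobar hy k) (Sum.inr v)
          (scalarMapH1_mem_inf S.ρbar (S.isScalarLinear_rhobar hy k)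
            (S.scalarMapH1_mem_residualSelmer_modify hy k {v} ∅ n) (S.scalarMapH1_mem_kerAdd hy k)))) = 1)
    (horm : (((((hy.h1 k).1.propagateStructure (S.t k).cond).modify (transverseStructure p S.ρbar S.jbar)
            {v} ∅ n)).selmerGroup ⊓
          (semilinearH S.cd.isLift (S.A k).θ.toAddMonoidHom (S.A k).isSemilinear 1 + AddMonoidHom.id _).ker).map
          (galoisCohomology.localization S.ρbar (Sum.inr v) 1) ≤
          ((hy.h1 k).1.propagateStructure (S.t k).cond) (Sum.inr v) ∨
      (((((hy.h1 k).1.propagateStructure (S.t k).cond).modify (transverseStructure p S.ρbar S.jbar)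
            {v} ∅ n)).selmerGroup ⊓
          (semilinearH S.cd.isLift (S.A k).θ.toAddMonoidHom (S.A k).isSemilinear 1 + AddMonoidHom.id _).ker).map
          (galoisCohomology.localization S.ρbar (Sum.inr v) 1) ≤
          transverseStructure p S.ρbar S.jbar (Sum.inr v)) :
    ρm k (insert v n) + 1 = ρm k n ∨ ρm k (insert v n) = ρm k n + 1 := by
  have h := S.length_eigen_insert_dichotomy hy k hvn _ (S.scalarMapH1_mem_kerAdd hy k) hdis hGDm horm
    (S.scalarMapH1_mem_residualSelmer_inf_ker_add hy k ∅ ∅ (insert v n))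
    (S.scalarMapH1_mem_residualSelmer_inf_ker_add hy k ∅ ∅ n)
  rw [← hρm _ (S.insert_subset_enginePrimes hn hv), ← hρm n hn] at h
  exact_mod_cast h

/-! ## §3 The binder `hpar` of the engine's Prop. 1.5.9 -/

/-- **«`ρ(n) (mod 2)` is independent of `n`» at level `k` and `n ⊆ 𝓛^{(2k-1)}`, from the five Lemma 1.5.3 letters at
the primes of `𝓛^{(2k-1)} ∖ n`** (binder shapes of `exists_enginePrime_caseI`: `hdis`, `hGDp`, `horp`, `hGDm`, `horm`)
and eigen-counts `ρ±` with the identifications `hρp` / `hρm` of `exists_eigenLengths`: for every `q ∈ 𝓛^{(2k-1)} ∖ n`,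
`dim_{R/(π)} 𝓗_k(n)[π] ≡ dim_{R/(π)} 𝓗_k(nq)[π] (mod 2)` — §2 at `q`, then (PAR-ASM) `finrank_torsionBy_mod_two_eq_of_rho`
(the `∓1`'s cancel mod 2).
[cite: Howard2004HeegnerKolyvagin, Lemma 1.5.3 («In particular …») and the proof of Prop. 1.5.9 (arXiv:1202.6340 p. 9 L139 – p. 10 L2, p. 10 L139–141)] -/
theorem engine_hpar_at (S : DVRSetting p K R N Rk Nbar Nq) (hy : S.SatisfiesH)
    (ρp ρm : ℕ → Finset (HeightOneSpectrum (𝓞 K)) → ℕ)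
    (hρp : ∀ (k : ℕ) (n : Finset (HeightOneSpectrum (𝓞 K))), ↑n ⊆ S.enginePrimes k →
      letI := galoisCohomology.moduleH1 S.ρbar (S.isScalarLinear_rhobar hy k)
      (ρp k n : ℕ∞) = Module.length (Rk k) ↥(galoisCohomology.submoduleOfStable (S.isScalarLinear_rhobar hy k)
        ((((hy.h1 k).1.propagateStructure (S.t k).cond).modify (transverseStructure p S.ρbar S.jbar)
            ∅ ∅ n).selmerGroup ⊓
          (semilinearH S.cd.isLift (S.A k).θ.toAddMonoidHom (S.A k).isSemilinear 1 - AddMonoidHom.id _).ker)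
        (S.scalarMapH1_mem_residualSelmer_inf_ker_sub hy k ∅ ∅ n)))
    (hρm : ∀ (k : ℕ) (n : Finset (HeightOneSpectrum (𝓞 K))), ↑n ⊆ S.enginePrimes k →
      letI := galoisCohomology.moduleH1 S.ρbar (S.isScalarLinear_rhobar hy k)
      (ρm k n : ℕ∞) = Module.length (Rk k) ↥(galoisCohomology.submoduleOfStable (S.isScalarLinear_rhobar hy k)
        ((((hy.h1 k).1.propagateStructure (S.t k).cond).modify (transverseStructure p S.ρbar S.jbar)
            ∅ ∅ n).selmerGroup ⊓
          (semilinearH S.cd.isLift (S.A k).θ.toAddMonoidHom (S.A k).isSemilinear 1 + AddMonoidHom.id _).ker)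
        (S.scalarMapH1_mem_residualSelmer_inf_ker_add hy k ∅ ∅ n)))
    (k : ℕ) {n : Finset (HeightOneSpectrum (𝓞 K))} (hn : ↑n ⊆ S.enginePrimes k)
    (hdis : ∀ v ∈ S.enginePrimes k, v ∉ n →
      Disjoint (((hy.h1 k).1.propagateStructure (S.t k).cond) (Sum.inr v))
        (transverseStructure p S.ρbar S.jbar (Sum.inr v)))
    (hGDp : ∀ v ∈ S.enginePrimes k, v ∉ n →
      letI := (galoisCohomology.moduleH1 (S.ρbar.toLocal (Sum.inr v))
        ((S.isScalarLinear_rhobar hy k).restrictField (Place.Completion (Sum.inr v))));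
      Module.length (Rk k) ↥(galoisCohomology.submoduleOfStable
        ((S.isScalarLinear_rhobar hy k).restrictField (Place.Completion (Sum.inr v)))
        ((((((hy.h1 k).1.propagateStructure (S.t k).cond).modify (transverseStructure p S.ρbar S.jbar)
            {v} ∅ n)).selmerGroup ⊓
          (semilinearH S.cd.isLift (S.A k).θ.toAddMonoidHom (S.A k).isSemilinear 1 - AddMonoidHom.id _).ker).map
          (galoisCohomology.localization S.ρbar (Sum.inr v) 1))
        (scalarMapH1_mem_map_localization S.ρbar (S.isScalarLinear_rhobar hy k) (Sum.inr v)
          (scalarMapH1_mem_inf S.ρbar (S.isScalarLinear_rhobar hy k)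
            (S.scalarMapH1_mem_residualSelmer_modify hy k {v} ∅ n) (S.scalarMapH1_mem_kerSub hy k)))) = 1)
    (horp : ∀ v ∈ S.enginePrimes k, v ∉ n →
      (((((hy.h1 k).1.propagateStructure (S.t k).cond).modify (transverseStructure p S.ρbar S.jbar)
            {v} ∅ n)).selmerGroup ⊓
          (semilinearH S.cd.isLift (S.A k).θ.toAddMonoidHom (S.A k).isSemilinear 1 - AddMonoidHom.id _).ker).map
          (galoisCohomology.localization S.ρbar (Sum.inr v) 1) ≤
          ((hy.h1 k).1.propagateStructure (S.t k).cond) (Sum.inr v) ∨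
      (((((hy.h1 k).1.propagateStructure (S.t k).cond).modify (transverseStructure p S.ρbar S.jbar)
            {v} ∅ n)).selmerGroup ⊓
          (semilinearH S.cd.isLift (S.A k).θ.toAddMonoidHom (S.A k).isSemilinear 1 - AddMonoidHom.id _).ker).map
          (galoisCohomology.localization S.ρbar (Sum.inr v) 1) ≤
          transverseStructure p S.ρbar S.jbar (Sum.inr v))
    (hGDm : ∀ v ∈ S.enginePrimes k, v ∉ n →
      letI := (galoisCohomology.moduleH1 (S.ρbar.toLocal (Sum.inr v))
        ((S.isScalarLinear_rhobar hy k).restrictField (Place.Completion (Sum.inr v))));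
      Module.length (Rk k) ↥(galoisCohomology.submoduleOfStable
        ((S.isScalarLinear_rhobar hy k).restrictField (Place.Completion (Sum.inr v)))
        ((((((hy.h1 k).1.propagateStructure (S.t k).cond).modify (transverseStructure p S.ρbar S.jbar)
            {v} ∅ n)).selmerGroup ⊓
          (semilinearH S.cd.isLift (S.A k).θ.toAddMonoidHom (S.A k).isSemilinear 1 + AddMonoidHom.id _).ker).map
          (galoisCohomology.localization S.ρbar (Sum.inr v) 1))
        (scalarMapH1_mem_map_localization S.ρbar (S.isScalarLinear_rhobar hy k) (Sum.inr v)
          (scalarMapH1_mem_inf S.ρbar (S.isScalarLinear_rhobar hy k)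
            (S.scalarMapH1_mem_residualSelmer_modify hy k {v} ∅ n) (S.scalarMapH1_mem_kerAdd hy k)))) = 1)
    (horm : ∀ v ∈ S.enginePrimes k, v ∉ n →
      (((((hy.h1 k).1.propagateStructure (S.t k).cond).modify (transverseStructure p S.ρbar S.jbar)
            {v} ∅ n)).selmerGroup ⊓
          (semilinearH S.cd.isLift (S.A k).θ.toAddMonoidHom (S.A k).isSemilinear 1 + AddMonoidHom.id _).ker).map
          (galoisCohomology.localization S.ρbar (Sum.inr v) 1) ≤
          ((hy.h1 k).1.propagateStructure (S.t k).cond) (Sum.inr v) ∨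
      (((((hy.h1 k).1.propagateStructure (S.t k).cond).modify (transverseStructure p S.ρbar S.jbar)
            {v} ∅ n)).selmerGroup ⊓
          (semilinearH S.cd.isLift (S.A k).θ.toAddMonoidHom (S.A k).isSemilinear 1 + AddMonoidHom.id _).ker).map
          (galoisCohomology.localization S.ρbar (Sum.inr v) 1) ≤
          transverseStructure p S.ρbar S.jbar (Sum.inr v)) :
    letI := galoisCohomology.moduleH1 (S.T.ρ k) (S.T.hlin k)
    ∀ (q : HeightOneSpectrum (𝓞 K)), q ∈ S.enginePrimes k → q ∉ n →
      Module.finrank (R ⧸ R ∙ S.π) ↥(Submodule.torsionBy R ↥(S.selmerModuleAt hy k n) S.π) % 2 =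
        Module.finrank (R ⧸ R ∙ S.π) ↥(Submodule.torsionBy R ↥(S.selmerModuleAt hy k (insert q n)) S.π) % 2 := by
  intro q hq hqn
  exact S.finrank_torsionBy_mod_two_eq_of_rho hy ρp ρm hρp hρm k n q hn hq
    (S.rho_insert_dichotomy_plus hy k ρp (hρp k) hn hq hqn (hdis q hq hqn) (hGDp q hq hqn) (horp q hq hqn))
    (S.rho_insert_dichotomy_minus hy k ρm (hρm k) hn hq hqn (hdis q hq hqn) (hGDm q hq hqn) (horm q hq hqn))

/-- **The parity binder `hpar` of `engine_h159` from the Lemma 1.5.3 letters, packaged over all `(k, n)`**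
(«in particular `ρ(n) (mod 2)` is independent of `n`» at EVERY `q ∈ 𝓛^{(2k-1)} ∖ n`): for eigen-counts `ρ±`
with the identifications `hρp` / `hρm` of `exists_eigenLengths`, Prop. 1.1.9's `F̄_v ∩ 𝒯̄_v = 0` at the primes of
`𝓛^{(2k-1)}` (`hdis`, level-`k` shape) and, for every `n ⊆ 𝓛^{(2k-1)}`, the conjunction
«(GD-line)⁺ ∧ (GD-line)⁻ ∧ (dichotomy)⁺ ∧ (dichotomy)⁻» at the primes of `𝓛^{(2k-1)} ∖ n` (`hGD`, the four
conjuncts in the binder shapes `hGDp`, `hGDm`, `horp`, `horm` of `exists_enginePrime_caseI`), the conclusion is the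
tenth binder `hpar` of `DVRSettingEngineH159Proofs.engine_h159` verbatim.  (The four letters are taken as ONE
hypothesis per `(k, n)`: five separately `∀ (k) (n)`-quantified binders of this size exhaust the default heartbeat
budget at elaboration, the bundled form elaborates in seconds.)
[cite: Howard2004HeegnerKolyvagin, Lemma 1.5.3 («In particular …») and the proof of Prop. 1.5.9 (arXiv:1202.6340 p. 9 L139 – p. 10 L2, p. 10 L139–141)] -/
theorem engine_hpar_of_letters (S : DVRSetting p K R N Rk Nbar Nq) (hy : S.SatisfiesH)
    (ρp ρm : ℕ → Finset (HeightOneSpectrum (𝓞 K)) → ℕ)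
    (hρp : ∀ (k : ℕ) (n : Finset (HeightOneSpectrum (𝓞 K))), ↑n ⊆ S.enginePrimes k →
      letI := galoisCohomology.moduleH1 S.ρbar (S.isScalarLinear_rhobar hy k)
      (ρp k n : ℕ∞) = Module.length (Rk k) ↥(galoisCohomology.submoduleOfStable (S.isScalarLinear_rhobar hy k)
        ((((hy.h1 k).1.propagateStructure (S.t k).cond).modify (transverseStructure p S.ρbar S.jbar)
            ∅ ∅ n).selmerGroup ⊓
          (semilinearH S.cd.isLift (S.A k).θ.toAddMonoidHom (S.A k).isSemilinear 1 - AddMonoidHom.id _).ker)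
        (S.scalarMapH1_mem_residualSelmer_inf_ker_sub hy k ∅ ∅ n)))
    (hρm : ∀ (k : ℕ) (n : Finset (HeightOneSpectrum (𝓞 K))), ↑n ⊆ S.enginePrimes k →
      letI := galoisCohomology.moduleH1 S.ρbar (S.isScalarLinear_rhobar hy k)
      (ρm k n : ℕ∞) = Module.length (Rk k) ↥(galoisCohomology.submoduleOfStable (S.isScalarLinear_rhobar hy k)
        ((((hy.h1 k).1.propagateStructure (S.t k).cond).modify (transverseStructure p S.ρbar S.jbar)
            ∅ ∅ n).selmerGroup ⊓
          (semilinearH S.cd.isLift (S.A k).θ.toAddMonoidHom (S.A k).isSemilinear 1 + AddMonoidHom.id _).ker)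
        (S.scalarMapH1_mem_residualSelmer_inf_ker_add hy k ∅ ∅ n)))
    (hdis : ∀ (k : ℕ) (v : HeightOneSpectrum (𝓞 K)) (_ : v ∈ S.enginePrimes k),
      Disjoint (((hy.h1 k).1.propagateStructure (S.t k).cond) (Sum.inr v))
        ((transverseStructure p S.ρbar S.jbar) (Sum.inr v)))
    (hGD : ∀ (k : ℕ) (n : Finset (HeightOneSpectrum (𝓞 K))), ↑n ⊆ S.enginePrimes k →
      (∀ v ∈ S.enginePrimes k, v ∉ n →
        letI := (galoisCohomology.moduleH1 (S.ρbar.toLocal (Sum.inr v))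
          ((S.isScalarLinear_rhobar hy k).restrictField (Place.Completion (Sum.inr v))));
        Module.length (Rk k) ↥(galoisCohomology.submoduleOfStable
          ((S.isScalarLinear_rhobar hy k).restrictField (Place.Completion (Sum.inr v)))
          ((((((hy.h1 k).1.propagateStructure (S.t k).cond).modify (transverseStructure p S.ρbar S.jbar)
              {v} ∅ n).selmerGroup) ⊓
            (semilinearH S.cd.isLift (S.A k).θ.toAddMonoidHom (S.A k).isSemilinear 1 - AddMonoidHom.id _).ker).map
            (galoisCohomology.localization S.ρbar (Sum.inr v) 1))
          (scalarMapH1_mem_map_localization S.ρbar (S.isScalarLinear_rhobar hy k) (Sum.inr v)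
            (scalarMapH1_mem_inf S.ρbar (S.isScalarLinear_rhobar hy k)
              (S.scalarMapH1_mem_residualSelmer_modify hy k {v} ∅ n) (S.scalarMapH1_mem_kerSub hy k)))) = 1) ∧
      (∀ v ∈ S.enginePrimes k, v ∉ n →
        letI := (galoisCohomology.moduleH1 (S.ρbar.toLocal (Sum.inr v))
          ((S.isScalarLinear_rhobar hy k).restrictField (Place.Completion (Sum.inr v))));
        Module.length (Rk k) ↥(galoisCohomology.submoduleOfStable
          ((S.isScalarLinear_rhobar hy k).restrictField (Place.Completion (Sum.inr v)))
          ((((((hy.h1 k).1.propagateStructure (S.t k).cond).modify (transverseStructure p S.ρbar S.jbar)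
              {v} ∅ n).selmerGroup) ⊓
            (semilinearH S.cd.isLift (S.A k).θ.toAddMonoidHom (S.A k).isSemilinear 1 + AddMonoidHom.id _).ker).map
            (galoisCohomology.localization S.ρbar (Sum.inr v) 1))
          (scalarMapH1_mem_map_localization S.ρbar (S.isScalarLinear_rhobar hy k) (Sum.inr v)
            (scalarMapH1_mem_inf S.ρbar (S.isScalarLinear_rhobar hy k)
              (S.scalarMapH1_mem_residualSelmer_modify hy k {v} ∅ n) (S.scalarMapH1_mem_kerAdd hy k)))) = 1) ∧
      (∀ v ∈ S.enginePrimes k, v ∉ n →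
        (((((hy.h1 k).1.propagateStructure (S.t k).cond).modify (transverseStructure p S.ρbar S.jbar)
              {v} ∅ n).selmerGroup) ⊓
            (semilinearH S.cd.isLift (S.A k).θ.toAddMonoidHom (S.A k).isSemilinear 1 - AddMonoidHom.id _).ker).map
            (galoisCohomology.localization S.ρbar (Sum.inr v) 1) ≤
            (((hy.h1 k).1.propagateStructure (S.t k).cond) (Sum.inr v)) ∨
        (((((hy.h1 k).1.propagateStructure (S.t k).cond).modify (transverseStructure p S.ρbar S.jbar)
              {v} ∅ n).selmerGroup) ⊓
            (semilinearH S.cd.isLift (S.A k).θ.toAddMonoidHom (S.A k).isSemilinear 1 - AddMonoidHom.id _).ker).map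
            (galoisCohomology.localization S.ρbar (Sum.inr v) 1) ≤
            ((transverseStructure p S.ρbar S.jbar) (Sum.inr v))) ∧
      (∀ v ∈ S.enginePrimes k, v ∉ n →
        (((((hy.h1 k).1.propagateStructure (S.t k).cond).modify (transverseStructure p S.ρbar S.jbar)
              {v} ∅ n).selmerGroup) ⊓
            (semilinearH S.cd.isLift (S.A k).θ.toAddMonoidHom (S.A k).isSemilinear 1 + AddMonoidHom.id _).ker).map
            (galoisCohomology.localization S.ρbar (Sum.inr v) 1) ≤
            (((hy.h1 k).1.propagateStructure (S.t k).cond) (Sum.inr v)) ∨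
        (((((hy.h1 k).1.propagateStructure (S.t k).cond).modify (transverseStructure p S.ρbar S.jbar)
              {v} ∅ n).selmerGroup) ⊓
            (semilinearH S.cd.isLift (S.A k).θ.toAddMonoidHom (S.A k).isSemilinear 1 + AddMonoidHom.id _).ker).map
            (galoisCohomology.localization S.ρbar (Sum.inr v) 1) ≤
            ((transverseStructure p S.ρbar S.jbar) (Sum.inr v)))) :
    letI := fun k => galoisCohomology.moduleH1 (S.T.ρ k) (S.T.hlin k)
    ∀ (k : ℕ) (n : Finset (HeightOneSpectrum (𝓞 K))) (q : HeightOneSpectrum (𝓞 K)),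
      ↑n ⊆ S.enginePrimes k → q ∈ S.enginePrimes k → q ∉ n →
      Module.finrank (R ⧸ R ∙ S.π) ↥(Submodule.torsionBy R ↥(S.selmerModuleAt hy k n) S.π) % 2 =
        Module.finrank (R ⧸ R ∙ S.π) ↥(Submodule.torsionBy R ↥(S.selmerModuleAt hy k (insert q n)) S.π) % 2 := by
  intro k n q hn hq hqn
  obtain ⟨hGDp, hGDm, horp, horm⟩ := hGD k n hn
  exact S.engine_hpar_at hy ρp ρm hρp hρm k hn (fun v hv _ => hdis k v hv) hGDp horp hGDm horm q hq hqn

end DVRSetting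

end Literature.NumberTheory.GaloisCohomology.Howard2004

end
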